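import Mathlib
import Summits.Ventures.PercRepro2.K5Hyper

/-!
# THE `TvT-(ii)` CERTIFICATES, PART C: `N(H + △(1,1,1)) ≥ N(H + T(1))` AT EVERY `K₅` PROFILE
(blind cell PercRepro2, typer-1 g10; mine-1 §23.1 `TvT-(ii)`, engine D244 the second code)

One `decide +kernel` per triangle `T = {a, b, c}` of marks (`K5Hyper.lean`: `CertLE (kNegTvT a b c)
(kPosTvT a b c)` — `kNeg ≤ kPos` digitwise in base `2^23`, the two mask tests at bit `22`).  Triangles
containing both roots `{a₁, a₂} = {1, 2}` have both sides identically `0`.  Twin `k5hyper_typer.py`: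
`0` violations on all `10` triangles.
-/

namespace Summit.Ventures.PercRepro2

namespace K5

set_option maxRecDepth 100000 in
/-- `TvT-(ii) ≥ 0` on the triangle `T = {1, 3, 4}`. -/
theorem cert_TvT_134 : CertLE (kNegTvT 1 3 4) (kPosTvT 1 3 4) := by
  unfold CertLE
  decide +kernel

set_option maxRecDepth 100000 in
/-- `TvT-(ii) ≥ 0` on the triangle `T = {2, 3, 4}`. -/
theorem cert_TvT_234 : CertLE (kNegTvT 2 3 4) (kPosTvT 2 3 4) := by
  unfold CertLE
  decide +kernel

end K5

end Summit.Ventures.PercRepro2
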